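import Mathlib
import Literature.Barriers.ValiantsHypothesis.AlgebraicNaturalProofs
import Summits.ValiantsHypothesis.ValiantsHypothesis.Theorems.BarrierLeverSuccinctHittingSetsForVPStubFewLinearForms
import HarnessLib

/-!
# Crux `BarrierLever.SuccinctHittingSetsForVP` (stmt-ValiantsHypothesis-14610), line `registered` —
AFFINE FORMS BECOME IRREDUCIBLE UNDER THE TWO-SEED SEPARABLE GENERATOR (registered stub
`stub_affineFormIrreducible`, wave 7)

**What is proved (unconditional; a tool for the `ΣΠΣ(2)` carve-out, it does NOT close the item).**
In FSV's framework over `ℂ` (coefficient variables `c_μ`, `μ ∈ degLEMonomials n`), the TWO-SEED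
SEPARABLE GENERATOR is the substitution
`Γ₂ : c_μ ↦ Σ_{r < 2} y_r ∏_i s_{r,i}^{μ_i}` into the polynomial ring
`A = ℂ[y_r, s_{r,i} : r < 2, i < n] = MvPolynomial (Fin 2 ⊕ (Fin 2 × Fin n)) ℂ`.
For an affine form `ℓ = a₀ + Σ_μ a_μ c_μ` of total degree exactly `1` (so some `a_μ ≠ 0`),
`ℓ ∘ Γ₂ = a₀ + y₀ P(s₀) + y₁ P(s₁)` with `P(s) = Σ_μ a_μ s^μ ≠ 0`, and this polynomial is
IRREDUCIBLE in `A`: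

* `AffineFormIrreducible.eq_affine_of_totalDegree_le_one` : the affine expansion
  `ℓ = C a₀ + Σ_μ C a_μ · X_μ` of a polynomial of total degree `≤ 1` (from the evaluation form
  `FewLinearForms.eval_eq_of_totalDegree_le_one` and `MvPolynomial.funext`);
* `AffineFormIrreducible.exists_coeff_single_ne_zero` : total degree `= 1` forces a nonzero
  linear coefficient;
* `AffineFormIrreducible.sum_monomial_ne_zero`, `….degreeOf_sum_C_mul_prod_eq_zero` :
  `P(s_r) ≠ 0` (distinct `μ` give distinct monomials `s_r^μ`) and `P(s_r)` does not involve the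
  variables `s_{r',i}`, `r' ≠ r`;
* `AffineFormIrreducible.isUnit_of_dvd_of_dvd` : a common divisor of `P(s₀)` and `P(s₁)` involves
  no variable at all (`degreeOf` is additive on nonzero products over a domain), hence is a nonzero
  constant, a unit;
* `stub_affineFormIrreducible` (registered stub) : irreducibility of `ℓ ∘ Γ₂`.

Proof of the stub: through the algebra isomorphism
`MvPolynomial.sumAlgEquiv : A ≃ₐ[ℂ] B[y₀, y₁]`, `B = ℂ[s] = MvPolynomial (Fin 2 × Fin n) ℂ`
(irreducibility is invariant, `MulEquiv.irreducible_iff`), `ℓ ∘ Γ₂` becomes the polynomial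
`C a₀ + y₀ · C P(s₀) + y₁ · C P(s₁)` of total degree `1` over the domain `B` whose coefficients
`P(s₀), P(s₁)` have only unit common divisors; such a polynomial is irreducible
(`MvPolynomial.irreducible_of_totalDegree_eq_one`: in a factorisation the total degrees add, so one
factor is a constant `C d`, and `d` divides every coefficient). Axioms: `propext`,
`Classical.choice`, `Quot.sound`. References: [ForbesShpilkaVolk2018] Question 6 (framework); the
irreducibility of primitive degree-one polynomials is folklore (Gauss).
-/

-- layout Summits/ValiantsHypothesis/ValiantsHypothesis forces the duplicated namespace component
set_option linter.dupNamespace false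

namespace Summit.ValiantsHypothesis.ValiantsHypothesis.Theorems.BarrierLever.SuccinctHittingSetsForVP

open Literature.Barriers.ValiantsHypothesis Literature.Computability.AlgebraicComplexity MvPolynomial

namespace AffineFormIrreducible

variable {ι : Type*}

/-- **Affine expansion, polynomial form.** A polynomial `p` over `ℂ` in finitely many variables of
total degree `≤ 1` is the affine form `p = C (coeff_0 p) + Σ_μ C (coeff_{x_μ} p) · X_μ`
(both sides have the same evaluations, `FewLinearForms.eval_eq_of_totalDegree_le_one`, and `ℂ` is
infinite). [folklore] -/
theorem eq_affine_of_totalDegree_le_one [Fintype ι] {p : MvPolynomial ι ℂ}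
    (hp : p.totalDegree ≤ 1) :
    p = C (coeff 0 p) + ∑ μ, C (coeff (Finsupp.single μ 1) p) * X μ := by
  apply MvPolynomial.funext
  intro c
  rw [FewLinearForms.eval_eq_of_totalDegree_le_one hp c]
  simp only [map_add, map_sum, map_mul, eval_C, eval_X]

/-- A polynomial over `ℂ` in finitely many variables of total degree exactly `1` has a nonzero
linear coefficient `coeff_{x_μ} p ≠ 0` (otherwise it is the constant `C (coeff_0 p)`).
[folklore] -/
theorem exists_coeff_single_ne_zero [Fintype ι] {p : MvPolynomial ι ℂ}
    (hp : p.totalDegree = 1) : ∃ μ, coeff (Finsupp.single μ 1) p ≠ 0 := by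
  by_contra h
  push Not at h
  have h1 := eq_affine_of_totalDegree_le_one hp.le
  simp only [h, C_0, zero_mul, Finset.sum_const_zero, add_zero] at h1
  rw [h1, totalDegree_C] at hp
  exact zero_ne_one hp

/-- The monomial `∏_i s_{r,i}^{μ_i}` of `ℂ[s] = MvPolynomial (Fin 2 × Fin n) ℂ` is
`monomial (μ.mapDomain (r, ·)) 1`. [folklore] -/
theorem prod_X_pow_eq_monomial {n : ℕ} (r : Fin 2) (μ : Fin n →₀ ℕ) :
    (∏ i : Fin n, X (r, i) ^ μ i : MvPolynomial (Fin 2 × Fin n) ℂ) =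
      monomial (μ.mapDomain (Prod.mk r)) 1 := by
  rw [monomial_eq, C_1, one_mul, Finsupp.prod_mapDomain_index_inj (Prod.mk_right_injective r),
    Finsupp.prod_pow]

/-- `P(s_r) = Σ_μ a_μ ∏_i s_{r,i}^{μ_i}` as a sum of monomials
`Σ_μ monomial (μ.mapDomain (r, ·)) a_μ`. [folklore] -/
theorem sum_C_mul_prod_eq {n : ℕ} [Fintype (degLEMonomials n)] (a : degLEMonomials n → ℂ)
    (r : Fin 2) :
    (∑ μ : degLEMonomials n, C (a μ) * ∏ i : Fin n, X (r, i) ^ (μ : Fin n →₀ ℕ) i :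
      MvPolynomial (Fin 2 × Fin n) ℂ) =
      ∑ μ : degLEMonomials n, monomial ((μ : Fin n →₀ ℕ).mapDomain (Prod.mk r)) (a μ) := by
  refine Finset.sum_congr rfl fun μ _ => ?_
  rw [prod_X_pow_eq_monomial, C_mul_monomial, mul_one]

/-- `P(s_r) = Σ_μ monomial (μ.mapDomain (r, ·)) a_μ ≠ 0` as soon as some `a_μ ≠ 0`: distinct
exponent vectors `μ` give distinct monomials (`μ ↦ μ.mapDomain (r, ·)` is injective).
[folklore] -/
theorem sum_monomial_ne_zero {n : ℕ} [Fintype (degLEMonomials n)] {a : degLEMonomials n → ℂ}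
    {μ₀ : degLEMonomials n} (h : a μ₀ ≠ 0) (r : Fin 2) :
    (∑ μ : degLEMonomials n, monomial ((μ : Fin n →₀ ℕ).mapDomain (Prod.mk r)) (a μ) :
      MvPolynomial (Fin 2 × Fin n) ℂ) ≠ 0 := by
  classical
  intro h0
  have hinj : Function.Injective
      fun μ : degLEMonomials n => (μ : Fin n →₀ ℕ).mapDomain (Prod.mk r) :=
    (Finsupp.mapDomain_injective (Prod.mk_right_injective r)).comp Subtype.val_injective
  have h2 := congr_arg (coeff ((μ₀ : Fin n →₀ ℕ).mapDomain (Prod.mk r))) h0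
  rw [coeff_sum, coeff_zero, Finset.sum_eq_single μ₀, coeff_monomial, if_pos rfl] at h2
  · exact h h2
  · intro μ _ hμ
    rw [coeff_monomial, if_neg (hinj.ne hμ)]
  · exact fun h' => absurd (Finset.mem_univ μ₀) h'

/-- `P(s_r) = Σ_μ a_μ ∏_j s_{r,j}^{μ_j}` does not involve the variables `s_{r',i}` for `r' ≠ r`:
`degreeOf (r', i) P(s_r) = 0`. [folklore] -/
theorem degreeOf_sum_C_mul_prod_eq_zero {n : ℕ} [Fintype (degLEMonomials n)]
    (a : degLEMonomials n → ℂ) {r r' : Fin 2} (hr : r' ≠ r) (i : Fin n) :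
    degreeOf (r', i) (∑ μ : degLEMonomials n, C (a μ) * ∏ j : Fin n, X (r, j) ^ (μ : Fin n →₀ ℕ) j :
      MvPolynomial (Fin 2 × Fin n) ℂ) = 0 := by
  apply Nat.eq_zero_of_le_zero
  refine (degreeOf_sum_le _ _ _).trans (Finset.sup_le fun μ _ => ?_)
  refine (degreeOf_C_mul_le _ _ _).trans ((degreeOf_prod_le _ _ _).trans ?_)
  refine (Finset.sum_eq_zero fun j _ => ?_).le
  exact degreeOf_X_pow_of_ne _ fun h => hr (congrArg Prod.fst h)

/-- **Coprimality across disjoint variable sets.** In the domain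
`ℂ[s] = MvPolynomial (Fin 2 × Fin n) ℂ`, if `P₀ ≠ 0` involves no variable `s_{1,i}` and `P₁ ≠ 0`
involves no variable `s_{0,i}`, then every common divisor `d` of `P₀` and `P₁` is a unit:
`degreeOf` is additive on nonzero products (`MvPolynomial.degreeOf_mul_eq`), so `d` involves no
variable, `d = C c` with `c ≠ 0`. [folklore] -/
theorem isUnit_of_dvd_of_dvd {n : ℕ} {P₀ P₁ d : MvPolynomial (Fin 2 × Fin n) ℂ} (h0 : P₀ ≠ 0)
    (h1 : P₁ ≠ 0) (hd0 : ∀ i, degreeOf (1, i) P₀ = 0) (hd1 : ∀ i, degreeOf (0, i) P₁ = 0)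
    (hdvd0 : d ∣ P₀) (hdvd1 : d ∣ P₁) : IsUnit d := by
  have aux : ∀ {P : MvPolynomial (Fin 2 × Fin n) ℂ} (v : Fin 2 × Fin n), P ≠ 0 → d ∣ P →
      degreeOf v d ≤ degreeOf v P := by
    rintro P v hP ⟨q, rfl⟩
    rw [degreeOf_mul_eq (left_ne_zero_of_mul hP) (right_ne_zero_of_mul hP)]
    exact Nat.le_add_right _ _
  have key : ∀ v, degreeOf v d = 0 := by
    rintro ⟨r, i⟩
    have hr : r = 0 ∨ r = 1 := by fin_cases r <;> simp
    rcases hr with rfl | rfl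
    · exact Nat.eq_zero_of_le_zero ((aux (0, i) h1 hdvd1).trans_eq (hd1 i))
    · exact Nat.eq_zero_of_le_zero ((aux (1, i) h0 hdvd0).trans_eq (hd0 i))
  have hvars : d.vars = ∅ :=
    Finset.eq_empty_of_forall_notMem fun v hv => (mem_vars_iff_degreeOf_ne_zero.mp hv) (key v)
  have hdC : d = C (coeff 0 d) := vars_eq_empty_iff_eq_C.mp hvars
  have hc : coeff 0 d ≠ 0 := by
    intro hc
    apply h0
    obtain ⟨q, rfl⟩ := hdvd0
    rw [hdC, hc, C_0, zero_mul]
  rw [hdC]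
  exact (IsUnit.mk0 _ hc).map C

/-- The linear coefficients of `C b + Σ_{s < 2} X_s · C (P s) ∈ B[y₀, y₁]`: the coefficient of
`y_r` is `P r`. [folklore] -/
theorem coeff_single_C_add_sum {B : Type*} [CommSemiring B] (b : B) (P : Fin 2 → B) (r : Fin 2) :
    coeff (Finsupp.single r 1) (C b + ∑ s : Fin 2, X s * C (P s) : MvPolynomial (Fin 2) B) =
      P r := by
  classical
  have hX : ∀ s : Fin 2, (X s * C (P s) : MvPolynomial (Fin 2) B) =
      monomial (Finsupp.single s 1) (P s) := fun s => by
    rw [mul_comm, C_mul_X_eq_monomial]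
  simp only [hX, coeff_add, coeff_C, coeff_sum, coeff_monomial, Finsupp.single_left_inj one_ne_zero]
  rw [if_neg (Ne.symm (Finsupp.single_ne_zero.mpr one_ne_zero)), zero_add, Finset.sum_ite_eq',
    if_pos (Finset.mem_univ _)]

/-- `C b + Σ_{s < 2} X_s · C (P s) ∈ B[y₀, y₁]` has total degree `≤ 1`. [folklore] -/
theorem totalDegree_C_add_sum_le {B : Type*} [CommSemiring B] [Nontrivial B] (b : B)
    (P : Fin 2 → B) :
    (C b + ∑ s : Fin 2, X s * C (P s) : MvPolynomial (Fin 2) B).totalDegree ≤ 1 := by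
  refine (totalDegree_add _ _).trans (max_le ?_ ?_)
  · rw [totalDegree_C]
    exact Nat.zero_le _
  · refine totalDegree_finsetSum_le fun s _ => (totalDegree_mul _ _).trans ?_
    rw [totalDegree_C, add_zero, totalDegree_X]

end AffineFormIrreducible

open AffineFormIrreducible

/-- **Registered stub `stub_affineFormIrreducible`** (crux stmt-ValiantsHypothesis-14610, line
`registered`, wave 7; affine forms become irreducible under the two-seed separable generator):
for every affine form `ℓ = a₀ + Σ_μ a_μ c_μ` of the coefficient variables with `totalDegree ℓ = 1`,
its image `a₀ + y₀ P(s₀) + y₁ P(s₁)`, `P(s) = Σ_μ a_μ s^μ`, under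
`Γ₂ : c_μ ↦ Σ_{r<2} y_r ∏_i s_{r,i}^{μ_i}` is irreducible in
`ℂ[y, s] = MvPolynomial (Fin 2 ⊕ (Fin 2 × Fin n)) ℂ`. Proof: under
`MvPolynomial.sumAlgEquiv : ℂ[y, s] ≃ₐ[ℂ] ℂ[s][y]` the image is the polynomial
`C a₀ + y₀ C P(s₀) + y₁ C P(s₁)` of total degree `1` over the domain `ℂ[s]`; `P(s₀) ≠ 0`
(some `a_μ ≠ 0`, distinct `μ` give distinct monomials) lives in `ℂ[s₀]` and `P(s₁) ≠ 0` in
`ℂ[s₁]`, so their common divisors are nonzero constants (`degreeOf` is additive over a domain),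
and a total-degree-one polynomial with coprime coefficients over a domain is irreducible
(`MvPolynomial.irreducible_of_totalDegree_eq_one`). [folklore] -/
theorem stub_affineFormIrreducible :
    ∀ (n : ℕ) (ℓ : MvPolynomial (degLEMonomials n) ℂ), ℓ.totalDegree = 1 →
      Irreducible (MvPolynomial.aeval
        (fun μ : degLEMonomials n => ∑ r : Fin 2,
            (X (Sum.inl r) : MvPolynomial (Fin 2 ⊕ (Fin 2 × Fin n)) ℂ) *
              ∏ i : Fin n, X (Sum.inr (r, i)) ^ (μ : Fin n →₀ ℕ) i) ℓ) := by
  intro n ℓ hℓ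
  classical
  haveI : Fintype (degLEMonomials n) := (Finsupp.finite_of_degree_le (σ := Fin n) n).fintype
  -- the coefficients of the affine form `ℓ = a₀ + Σ_μ a μ • c_μ`; one linear coefficient is nonzero
  set a₀ : ℂ := coeff 0 ℓ with ha₀
  set a : degLEMonomials n → ℂ := fun μ => coeff (Finsupp.single μ 1) ℓ with ha
  have hℓa : ℓ = C a₀ + ∑ μ, C (a μ) * X μ := eq_affine_of_totalDegree_le_one hℓ.le
  obtain ⟨μ₀, hμ₀⟩ : ∃ μ, a μ ≠ 0 := exists_coeff_single_ne_zero hℓ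
  -- `P r = P(s_r) = Σ_μ a_μ s_r^μ ∈ B = ℂ[s]`, nonzero
  set P : Fin 2 → MvPolynomial (Fin 2 × Fin n) ℂ := fun r =>
    ∑ μ : degLEMonomials n, C (a μ) * ∏ i : Fin n, X (r, i) ^ (μ : Fin n →₀ ℕ) i with hP
  have hP0 : ∀ r, P r ≠ 0 := fun r => by
    have h := sum_monomial_ne_zero hμ₀ r
    rwa [← sum_C_mul_prod_eq a r] at h
  -- the image of `ℓ ∘ Γ₂` in `B[y₀, y₁]`
  have himg : sumAlgEquiv ℂ (Fin 2) (Fin 2 × Fin n) (MvPolynomial.aeval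
        (fun μ : degLEMonomials n => ∑ r : Fin 2,
            (X (Sum.inl r) : MvPolynomial (Fin 2 ⊕ (Fin 2 × Fin n)) ℂ) *
              ∏ i : Fin n, X (Sum.inr (r, i)) ^ (μ : Fin n →₀ ℕ) i) ℓ) =
      C (C a₀) + ∑ r : Fin 2, X r * C (P r) := by
    rw [hℓa]
    simp only [map_add, map_sum, map_mul, map_prod, map_pow, aeval_C, aeval_X, algebraMap_eq,
      sumAlgEquiv_C_inl, sumAlgEquiv_X_inl, sumAlgEquiv_X_inr]
    congr 1
    simp only [hP, map_sum, map_mul, map_prod, map_pow, Finset.mul_sum]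
    rw [Finset.sum_comm]
    refine Finset.sum_congr rfl fun r _ => Finset.sum_congr rfl fun μ _ => ?_
    ring
  -- irreducibility of the image: total degree one, coprime coefficients over the domain `B`
  have key : Irreducible (C (C a₀) + ∑ r : Fin 2, X r * C (P r) :
      MvPolynomial (Fin 2) (MvPolynomial (Fin 2 × Fin n) ℂ)) := by
    refine irreducible_of_totalDegree_eq_one ?_ fun x hx => ?_
    · refine le_antisymm (totalDegree_C_add_sum_le _ _) ?_
      have hmem : Finsupp.single (0 : Fin 2) 1 ∈
          (C (C a₀) + ∑ r : Fin 2, X r * C (P r) :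
            MvPolynomial (Fin 2) (MvPolynomial (Fin 2 × Fin n) ℂ)).support := by
        rw [mem_support_iff, coeff_single_C_add_sum]
        exact hP0 0
      have h1 := monomial_le_degreeOf (0 : Fin 2) hmem
      rw [Finsupp.single_eq_same] at h1
      exact h1.trans (degreeOf_le_totalDegree _ _)
    · exact isUnit_of_dvd_of_dvd (hP0 0) (hP0 1)
        (fun i => degreeOf_sum_C_mul_prod_eq_zero a (by decide) i)
        (fun i => degreeOf_sum_C_mul_prod_eq_zero a (by decide) i)
        (by simpa only [coeff_single_C_add_sum] using hx (Finsupp.single 0 1))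
        (by simpa only [coeff_single_C_add_sum] using hx (Finsupp.single 1 1))
  rw [← himg] at key
  exact (MulEquiv.irreducible_iff (sumAlgEquiv ℂ (Fin 2) (Fin 2 × Fin n))).mp key

end Summit.ValiantsHypothesis.ValiantsHypothesis.Theorems.BarrierLever.SuccinctHittingSetsForVP
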